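import Literature.NumberTheory.FaltingsSerre.ResidualFrobeniusData
import Literature.NumberTheory.FaltingsSerre.CertificateConjTransfer
import Literature.NumberTheory.FaltingsSerre.ResidualRigidity
import Literature.NumberTheory.FaltingsSerre.ResidualSymplectic
import HarnessLib

/-!
# Core certificates along a residual conjugacy: ONE class-field block for two surfaces

[BPPTVY] = A. Brumer, A. Pacetti, C. Poor, G. Tornaría, J. Voight, D. S. Yuen, *On the paramodularity of
typical abelian surfaces*, Algebra & Number Theory **13**:5 (2019) 1145–1195 [cite: BrumerEtAl2019].

Steps 2–4 of [BPPTVY, Algorithm 2.4.1 p. 1156] ("2. … enumerate all `ℓ`-elementary abelian extensions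
`L ⊇ K` unramified away from `S` …; 3. … find all obstructing pairs `(L, φ)` extending `(K, ρ̄)` …;
4. For each such pair `(L, φ)`, find a prime `𝔭 ∉ S` such that `utr φ(Frob_𝔭) ≢ 0 (mod ℓ)`") take as
input only the residual representation `ρ̄` (through its fixed field `K`) and `S`; and absolute
irreducibility is a property of `ρ̄`.  Both are invariant under a change of residual frame
`ρ̄ ↦ ḡ ρ̄ ḡ⁻¹` with `ḡ ∈ Sp₄(𝔽₂) = ι(S₆)` (`complete_of_conj`, `IsAbsIrreducible.of_conj` of
`CertificateConjTransfer.lean`).  Hence a second surface `A'` of the same level whose residual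
representation is CONJUGATE to `ρ̄_A` inside `ι(S₆)` — the output of the residual-rigidity theorems
(`ResidualRigidity.lean`: same `2`-division field + one Frobenius datum) — re-uses the `complete` block
and `absIrreducible` of a core certificate for `A` (`CoreCertificate.lean`); only the per-pair data
(similitudes, Step 1 for `(ρ̄_{A'}, ρ̄_{f'})`, and — outside the certificate — the Euler data and the
Step-5 trace table of `(A', f')`) are new.  This is the shape of the cell's `587⁺` target relative to
the `587⁻` certificate (two LMFDB curves of conductor `587` with the same `2`-division field, image `S₆`
[BPPTVY, §7.3 p. 1191 for `A₅₈₇ = Jac(y² + (x³+x+1)y = −x²−x)`]).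

THIS FILE: `exists_residual_conj_of_eulerData` (the conjugating `π` PRODUCED from `im ρ̄_A = ι(S₆)`, the
same kernel field, and the order-`3` datum of `ResidualFrobeniusData.lean` read off the Euler factors at
ONE good odd prime with `a_q` even, `b_q` odd on both sides), `CoreCertificate.ofResidualConj` (transport of a core certificate along
`ρ̄_{A'} = ι(π) ρ̄_A ι(π)⁻¹`, new multiplier `ν'` allowed) and the instance template
`paramodular_of_coreCertificate_transfer` (conclusion `IsParamodularAwayFrom A' N f'`).
No new cited fact; pure bookkeeping over `CoreCertificate` and `CertificateConjTransfer`.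

## References
* [BPPTVY] Alg 2.4.1 p. 1156; (5.1.1)–(5.1.2) p. 1173; Thm 7.3.1 p. 1191. [cite: BrumerEtAl2019]
-/

noncomputable section

namespace Literature.NumberTheory.FaltingsSerre

open Matrix Equiv Field IsDedekindDomain Polynomial
open Literature.NumberTheory.GaloisRepresentations Literature.NumberTheory.FaltingsSerre.GSp4F2
  Literature.NumberTheory.Automorphic.Paramodular Literature.NumberTheory.Automorphic
  Literature.AlgebraicGeometry.Motives
open scoped NumberField

section CoreTransfer

variable {N : ℕ} {T : Finset ℕ} {ν ν' : absoluteGaloisGroup ℚ → ℤ_[2]}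
  {ρA ρf ρA' ρf' : FramedGaloisRep ℚ ℤ_[2] 4}

/-- **Core certificates along a residual conjugacy.**  A core certificate for `(ρA, ρf)` at level `N`
with check primes `T`, a permutation `π ∈ S₆` with `ρ̄_{A'} = ι(π) ρ̄_A ι(π)⁻¹` (`ι(π)` is automatically
symplectic for `J̄ = antiId4 (𝔽₂) = (antiIdAlt4 ℤ₂) mod 2`, `GSp4F2.mem_range_iotaGL`,
`antiIdAlt4_map_toZMod`), the similitude identities for the new pair (multiplier `ν'`) and Step 1 for
the new pair (`ρ̄_{f'} = ι(π₂) ρ̄_{A'} ι(π₂)⁻¹`) give a core certificate for `(ρA', ρf')` with the SAME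
`N`, `T`: `absIrreducible` by `IsAbsIrreducible.of_conj`, `complete` by `complete_of_conj` (Steps 2–4
depend on `ρ̄` and `S` only). [cite: BrumerEtAl2019, Alg 2.4.1 p. 1156; (5.1.1)–(5.1.2) p. 1173] -/
theorem CoreCertificate.ofResidualConj (C : CoreCertificate N T ν ρA ρf) (π : Perm (Fin 6))
    (h₁ : ∀ σ, residual ρA'.toMonoidHom σ =
      iotaGL π * residual ρA.toMonoidHom σ * (iotaGL π)⁻¹)
    (hs₁ : ∀ σ, IsSimilitude (antiIdAlt4 ℤ_[2]) (ν' σ)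
      ((ρA' σ : GL (Fin 4) ℤ_[2]) : Matrix (Fin 4) (Fin 4) ℤ_[2]))
    (hs₂ : ∀ σ, IsSimilitude (antiIdAlt4 ℤ_[2]) (ν' σ)
      ((ρf' σ : GL (Fin 4) ℤ_[2]) : Matrix (Fin 4) (Fin 4) ℤ_[2]))
    (h₂ : ∃ π₂ : Perm (Fin 6), ∀ σ, residual ρf'.toMonoidHom σ =
      iotaGL π₂ * residual ρA'.toMonoidHom σ * (iotaGL π₂)⁻¹) :
    CoreCertificate N T ν' ρA' ρf' where
  similitude₁ := hs₁
  similitude₂ := hs₂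
  residual_conj := h₂
  absIrreducible := IsAbsIrreducible.of_conj _ _ (iotaGL π) h₁ C.absIrreducible
  complete := by
    have hg : ((iotaGL π : GL (Fin 4) (ZMod 2)) : Matrix (Fin 4) (Fin 4) (ZMod 2))ᵀ *
        (antiIdAlt4 ℤ_[2]).map (PadicInt.toZMod (p := 2)) * (iotaGL π : GL (Fin 4) (ZMod 2)) =
        (antiIdAlt4 ℤ_[2]).map (PadicInt.toZMod (p := 2)) := by
      rw [antiIdAlt4_map_toZMod]
      exact (mem_range_iotaGL _).1 ⟨π, rfl⟩
    exact complete_of_conj _ _ _ (iotaGL π) hg h₁ _ _ C.complete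

variable {A' : AbelianVariety ℚ} {b' : Module.Basis (Fin 4) ℚ_[2] (A'.rationalTateModule 2)}

/-- **`A'` is paramodular of level `N` away from `N`, from the core certificate of ANOTHER pair
`(A, f)` with conjugate residual representation** — the instance template for a second surface of the
same level sharing the `2`-division field (cell target `587⁺` from the `587⁻` certificate).  Binders:
the core certificate `C` of `(ρA, ρf)`; the residual conjugacy `π`, `h₁` (from `ResidualRigidity.lean`
applied to the two surfaces' field data); similitudes `hs₁`, `hs₂` and Step 1 `h₂` for `(ρA', ρf')`;
then exactly the binders of `paramodular_of_coreCertificate` for `(A', f')`: `hframe'`, Euler data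
`aA' bA' af' bf'` with `hA'`, `hρf'_unr` [Thm 4.3.4 (iii)], `hρf'` [Thm 4.3.4 (iv)], `hT`, the trace
table `h5'`, the form `hcusp'`, `hne'`, `hfe'` and the hand check `h2'` at `p = 2`.
[cite: BrumerEtAl2019, Alg 2.4.1 p. 1156; Thm 7.3.1 p. 1191; Thm 2.1.5 p. 1150; Thm 4.3.4 p. 1169] -/
theorem paramodular_of_coreCertificate_transfer [NeZero N] {f' : Matrix (Fin 2) (Fin 2) ℂ → ℂ}
    (C : CoreCertificate N T ν ρA ρf) (π : Perm (Fin 6))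
    (h₁ : ∀ σ, residual ρA'.toMonoidHom σ =
      iotaGL π * residual ρA.toMonoidHom σ * (iotaGL π)⁻¹)
    (hs₁ : ∀ σ, IsSimilitude (antiIdAlt4 ℤ_[2]) (ν' σ)
      ((ρA' σ : GL (Fin 4) ℤ_[2]) : Matrix (Fin 4) (Fin 4) ℤ_[2]))
    (hs₂ : ∀ σ, IsSimilitude (antiIdAlt4 ℤ_[2]) (ν' σ)
      ((ρf' σ : GL (Fin 4) ℤ_[2]) : Matrix (Fin 4) (Fin 4) ℤ_[2]))
    (h₂ : ∃ π₂ : Perm (Fin 6), ∀ σ, residual ρf'.toMonoidHom σ =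
      iotaGL π₂ * residual ρA'.toMonoidHom σ * (iotaGL π₂)⁻¹)
    (hframe' : A'.IsFrameOfTateRep 2 b' (rationalize ρA')) (aA' bA' af' bf' : ℕ → ℤ)
    (hA' : ∀ p : ℕ, p.Prime → ¬ p ∣ N →
      A'.HasGoodEulerFactorAt p ((lPolynomialOfSurface p (aA' p) (bA' p)).map (Int.castRingHom ℚ)))
    (hρf'_unr : ∀ v ∉ placesOver (badPrimes N), ρf'.IsUnramifiedAt v)
    (hρf' : ∀ p : ℕ, p.Prime → ¬ p ∣ N → p ≠ 2 →
      ∀ v : HeightOneSpectrum (𝓞 ℚ), ((p : ℕ) : 𝓞 ℚ) ∈ v.asIdeal →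
        ρf'.HasFrobCharpolyAt v
          ((lPolynomialOfSurface p (af' p) (bf' p)).reverse.map (Int.castRingHom ℤ_[2])))
    (hT : ∀ p ∈ T, p.Prime ∧ ¬ p ∣ N ∧ p ≠ 2) (h5' : ∀ p ∈ T, aA' p = af' p)
    (hcusp' : IsParamodularCuspForm N 2 f') (hne' : ∃ Z ∈ siegelUpperHalfSpace 2, f' Z ≠ 0)
    (hfe' : ∀ p : ℕ, p.Prime → ¬ p ∣ N →
      HasSpinorEulerFactorAt 2 p f' ((lPolynomialOfSurface p (af' p) (bf' p)).map (Int.castRingHom ℂ)))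
    (h2' : ¬ 2 ∣ N → aA' 2 = af' 2 ∧ bA' 2 = bf' 2) :
    IsParamodularAwayFrom A' N f' :=
  paramodular_of_coreCertificate (C.ofResidualConj π h₁ hs₁ hs₂ h₂) hframe' aA' bA' af' bf' hA'
    hρf'_unr hρf' hT h5' hcusp' hne' hfe' h2'

/-- **The residual conjugacy `ρ̄_{A'} = ι(π) ρ̄_A ι(π)⁻¹` PRODUCED from certificate-level data** (image
`S₆`): `ρ̄_A` onto `ι(S₆)` (`h₁`; from `#im = 720` by `GSp4F2.residual_range_eq_iotaGL_of_card`),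
`ρ̄_{A'}` symplectic (its similitude datum), the same kernel field (`hker`), and Euler data at one good
odd prime `q` with `a_q` even, `b_q` odd on both sides (`exists_orderThree_datum_of_eulerData`).
[cite: BrumerEtAl2019, (5.1.8) p. 1174, (5.2.3) p. 1175 and Thm 7.3.1 p. 1191] -/
theorem exists_residual_conj_of_eulerData
    (h₁ : (residual ρA.toMonoidHom).range = iotaGL.range)
    (hs₁' : ∀ σ, IsSimilitude (antiIdAlt4 ℤ_[2]) (ν' σ)
      ((ρA' σ : GL (Fin 4) ℤ_[2]) : Matrix (Fin 4) (Fin 4) ℤ_[2]))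
    (hker : ∀ γ, residual ρA.toMonoidHom γ = 1 ↔ residual ρA'.toMonoidHom γ = 1)
    {A : AbelianVariety ℚ} {b : Module.Basis (Fin 4) ℚ_[2] (A.rationalTateModule 2)}
    (hframe : A.IsFrameOfTateRep 2 b (rationalize ρA))
    (hframe' : A'.IsFrameOfTateRep 2 b' (rationalize ρA')) {q : ℕ} (hq : q.Prime) (hq2 : q ≠ 2)
    {a c a' c' : ℤ}
    (hA : A.HasGoodEulerFactorAt q ((lPolynomialOfSurface q a c).map (Int.castRingHom ℚ)))
    (hA' : A'.HasGoodEulerFactorAt q ((lPolynomialOfSurface q a' c').map (Int.castRingHom ℚ)))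
    (ha : Even a) (hc : Odd c) (ha' : Even a') (hc' : Odd c') :
    ∃ π : Perm (Fin 6), ∀ σ, residual ρA'.toMonoidHom σ =
      iotaGL π * residual ρA.toMonoidHom σ * (iotaGL π)⁻¹ := by
  obtain ⟨u, hu3, hu1, htr⟩ :=
    exists_orderThree_datum_of_eulerData hframe hframe' hq hq2 hA hA' ha hc ha' hc'
  exact exists_conj_of_ker_iff_of_trace_orderThree _ _ h₁ (range_residual_le_iotaGL_framed ρA' ν' hs₁')
    hker hu3 hu1 htr

end CoreTransfer

end Literature.NumberTheory.FaltingsSerre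

end
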